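/-
Copyright (c) 2026 the pub-hodgecm-mathlib formalisation cell (harness21).  Prover seat hodgecm-mathlib-K2Liu-p14 (g4), Track B «K2-LIT»,
#184♮ = hLiu418 = `stmt-HodgeConjecture-24832`; socket #41, KIND 1 — (K1b-♮) THE LINE-TERM PACKAGE, writer of record (LEAD F0P6-plan (g14) BATCH #139 (1),
2026-09-04T23:23:38Z; heir of LH4-p14 (g7)'s SIG v0–v2 + memo v4 `F0/P3c/LH4/LH4-p14/g7/k1b/`).  ED. 1 = THE PACKAGE FROM FOUR LETTERS (hypothesis-first, interface of record).
THEOREMS ONLY (no `def`, no `instance`, no notation, no named-fact hypothesis, no `sorry`).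
-/
import Summits.HodgeConjecture.HodgeConjecture.Theorems.K2LiuKindOneLettersOfRecord       -- ★ p862409: the letters of record (vocabulary of the MID pin: `unipDeltaChar`, `SiegelDeltaQuot`, `wq`)
import Summits.HodgeConjecture.HodgeConjecture.Theorems.K2LiuKindOneWeightsOfDecay          -- ★ p862451: the `τb ∕ hdecb ∕ hsuppb` shapes (`adelicHeightGL`, mixed-embedding norm)
import Summits.HodgeConjecture.HodgeConjecture.Theorems.K2LiuEisensteinContinuationGlue     -- ★ `eqOn_of_eqOn_halfPlane` (identity theorem on a half-plane)
import HarnessLib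

/-!
# Crux `HLiu418`, socket #41, KIND 1 — (K1b-♮) THE LINE-TERM PACKAGE, ED. 1: THE TWELVE K1-b♮ LETTERS FROM FOUR
# `∃ Ebc, hEbd ∧ hEbc ∧ ∃ τb, hτb ∧ ∃ Nb, hdecb ∧ ∃ Cb κb, 0 < Cb ∧ 0 ≤ κb ∧ hsuppb` — from a holomorphic PIN `E`, its decay, and its support ON THE CONVERGENCE HALF-PLANE ONLY

Cell `hodgecm-mathlib`, crux item hLiu418 = `stmt-HodgeConjecture-24832` (helper lane `--supports … --as helper`, count-neutral), route of record `HCCMUnconditional`;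
squad K2 ∕ K2Liu, road `K2_Liu`, socket #41 `sig_K2LiuSiegelEisensteinContinuation`, KIND 1, block K1-b♮ = the by-value letters
`(Ebc hEbd hEbc τb hτb Nb hdecb {Cb κb} hCb hκb hsuppb)` of ★ ED. 20 `K2LiuSiegelEisensteinContinuationTopTwentySocket.siegelEisensteinContinuation_twenty` :109–:126
(= ★ ED. 16 :159–:180): the continued NORMALISED MIDDLE-CELL (line) term of a rank-one Fourier coefficient.  Writer of record K2Liu-p14 (g4) (BATCH #139 (1)), K1 desk successor.
THE ORGAN ((K1b-W), 17 ★ files, line words #1–#7 on the K2 bus) produces, for rank-one `S`, the PIN `E S s h = c_S · W⁽¹⁾_{σ♭(S)}(x ↦ f_s(p₀ · blkD(1,x) · Λĝ(S)h))(1)`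
(«continued = integral»: absolutely convergent and holomorphic on ALL of `{0 < re s}`, ★ p862650 ∕ ★ p862749), the pin identity on `{n∕2 < re s}` (★ p861327 → ★ p862584 → ★ p862629 →
★ p862409 §2), its height-form Gaussian decay (★ p862696∕p862865∕p863005 + (ρ4)), and — INTRINSICALLY, by the level of the middle-CELL function ((ρ1)(ρ2)(ρ3) → ★ `hsupp_of_local`) —
its bounded-denominator SUPPORT ON THE CONVERGENCE HALF-PLANE `{n∕2 < re s}` (where the pin IS the cell term).  THIS FILE is the interface of record those payers type to:
* §1 **`ne_zero_on_halfPlane_of_ne_zero`** — THE ONE ANALYTIC STEP OF THE PACKAGE: a function holomorphic on `{0 < re s}` that does not vanish at some point of `{0 < re s}` does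
  not vanish at some point of `{c < re s}` (`0 ≤ c`) — the identity theorem on the connected half-plane (★ `eqOn_of_eqOn_halfPlane`); so a SUPPORT letter proved on the
  convergence half-plane `{n∕2 < re s}` (an `s`-free conclusion) holds on the whole window `{0 < re s}` (`support_of_support_on_halfPlane`).
* §2 **`exists_kindOne_lineTermPackage_of_letters`** — THE K1-b♮ BLOCK, TOKEN FOR TOKEN, from FOUR LETTERS about ONE function `E : Skew → ℂ → H(𝔸) → ℂ`:
  (hol) `∀ S h, DifferentiableOn ℂ (fun s => E S s h) {0 < re}`; (pin) the TOP's MID identity `= E S s h` on `{n∕2 < re s}` for rank-one `S` (bytes of ★ ED. 20 :112–:120);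
  (dec) `(τb, hτb, Nb, hdec)` in the TOP's shape; (supp½) `∃ Cb κb, 0 < Cb ∧ 0 ≤ κb ∧ ∀ S s h, n∕2 < re s → E S s h ≠ 0 → ∃ D ≤ Cb·H(h)^κb, D·S integral` — support ON
  `{n∕2 < re s}` ONLY.  Output: the twelve letters with `Ebc := E` (`hsuppb` on `{0 < re s}` by §1).  The socket prefix `(L e dV … wq hwq)` is carried verbatim so the tie
  `obtain`s the block in one line.
[MoeglinWaldspurger1995, II.1.7, IV.1.9] [KudlaRallis1994, §2 (2.10)–(2.12)] [Tan1999, §4 Prop. 4.8] [Shimura1997, §18.4 Prop. 18.14] [Conway1978, IV.3 (identity theorem)].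
HONEST LABEL.  Count-neutral helper, hypothesis-first; it closes no socket by itself: `HC_CM` is proved only modulo the 7 printed citations (2 remaining named inputs:
hLiu418 = `stmt-HodgeConjecture-24832`, h413 = `stmt-HodgeConjecture-24833`) until rung 0 closes.  NOT HERE (the payers, named): (pin) `K2LiuKindOneLinePin` (the ★ chain
p861327 → p862584 → p862629 → p862409 §2 + `hEbd` by ★ p862749; K2Liu-p14 next), (dec) the (KW1-f′) fine form ★ LH4-p18 + (ρ4) K2E3-p03 `K2LiuKindOneLineCornerGramBound`,
(supp½) (ρ1) F0P2-p09 ∕ (ρ2) ★-cand F0P2-p10 ∕ (ρ3) F0P2-p09 `K2LiuKindOneLineCharacterBoundTwo` + ★ `hsupp_of_local`.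

## References
* [MoeglinWaldspurger1995] C. Mœglin, J.-L. Waldspurger, *Spectral decomposition and Eisenstein series* (1995): II.1.7, IV.1.9.
* [KudlaRallis1994] S. Kudla, S. Rallis, Ann. of Math. 140 (1994): §2 (2.10)–(2.12).   * [Tan1999] V. Tan, Canad. J. Math. 51 (1999): §4 Prop. 4.8.
* [Shimura1997] G. Shimura, CBMS 93 (1997): §18.4 Prop. 18.14.   * [Conway1978] J. B. Conway, *Functions of One Complex Variable I*: IV.3 (identity theorem).
-/

set_option autoImplicit false
-- the mandated namespace repeats the single-problem summit's segment (`HodgeConjecture.HodgeConjecture`)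
set_option linter.dupNamespace false

noncomputable section

open scoped Matrix ENNReal NNReal Topology ComplexConjugate
open NumberField IsDedekindDomain MeasureTheory MeasureTheory.Measure Filter Set Function Metric
open Literature.NumberTheory.Automorphic Literature.NumberTheory.Automorphic.UnitaryGroup Literature.NumberTheory.GaloisRepresentations
open Literature.NumberTheory.GelbartRogawski1991 Literature.NumberTheory.GelbartRogawski1991.GRConstruction
open Literature.NumberTheory.K2Lit.SiegelDoubled Literature.MeasureTheory.Group
open Literature.NumberTheory.Automorphic.IdeleClassGroup

namespace Summit.HodgeConjecture.HodgeConjecture.Cruxes.HLiu418.K2LiuKindOneLineTermPackage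

open K2LiuSiegelUnipotentFourierDefs K2LiuSiegelUnipotentCharacters K2LiuUnipotentCoveringWeight K2LiuSiegelFourierCoeffDelta
open K2LiuEisensteinContinuationGlue (eqOn_of_eqOn_halfPlane)

/-! ## §1 The one analytic step: a support letter on the convergence half-plane holds on the whole window -/

/-- **IDENTITY THEOREM ON THE WINDOW**: `g` holomorphic on `{0 < re s}`, `g s₀ ≠ 0` for some `0 < re s₀`, `0 ≤ c` ⇒ `g s₁ ≠ 0` for some `s₁` with `c < re s₁` (else `g = 0` on
`{c < re}` and ★ `eqOn_of_eqOn_halfPlane` forces `g = 0` on `{0 < re} ∖ {−1} ∋ s₀`). [cite: Conway1978, IV.3] [cite: MoeglinWaldspurger1995, IV.1.9] -/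
theorem ne_zero_on_halfPlane_of_ne_zero {g : ℂ → ℂ} (hg : DifferentiableOn ℂ g {s : ℂ | 0 < s.re}) {c : ℝ} (hc : 0 ≤ c) {s₀ : ℂ} (hs₀ : 0 < s₀.re)
    (hne : g s₀ ≠ 0) : ∃ s₁ : ℂ, c < s₁.re ∧ g s₁ ≠ 0 := by
  by_contra hall
  push Not at hall
  have h₁ : DifferentiableOn ℂ g ({s : ℂ | (0 : ℝ) < s.re} \ {(-1 : ℂ)}) := hg.mono Set.sdiff_subset
  have h₂ : DifferentiableOn ℂ (fun _ : ℂ => (0 : ℂ)) ({s : ℂ | (0 : ℝ) < s.re} \ {(-1 : ℂ)}) := differentiableOn_const 0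
  have heq := eqOn_of_eqOn_halfPlane (E₁ := g) (E₂ := fun _ => (0 : ℂ)) (s₀ := (-1 : ℂ)) hc h₁ h₂ (fun s hs => hall s hs)
  have hmem : s₀ ∈ ({s : ℂ | (0 : ℝ) < s.re} \ {(-1 : ℂ)}) := by
    refine ⟨hs₀, fun h => ?_⟩
    rw [Set.mem_singleton_iff] at h
    rw [h] at hs₀
    norm_num at hs₀
  exact hne (heq hmem)

/-- **A SUPPORT LETTER ON `{c < re s}` HOLDS ON `{0 < re s}`** (`0 ≤ c`): for a family `E : ι → ℂ → X → ℂ` holomorphic in `s` on the window and an `s`-FREE conclusion `P i x`,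
`(∀ i s x, c < re s → E i s x ≠ 0 → P i x) ⇒ (∀ i s x, 0 < re s → E i s x ≠ 0 → P i x)`. [cite: MoeglinWaldspurger1995, IV.1.9] [folklore] -/
theorem support_of_support_on_halfPlane {ι X : Type*} {E : ι → ℂ → X → ℂ} (hE : ∀ i x, DifferentiableOn ℂ (fun s => E i s x) {s : ℂ | 0 < s.re})
    {c : ℝ} (hc : 0 ≤ c) {P : ι → X → Prop} (hP : ∀ (i : ι) (s : ℂ) (x : X), c < s.re → E i s x ≠ 0 → P i x) :
    ∀ (i : ι) (s : ℂ) (x : X), 0 < s.re → E i s x ≠ 0 → P i x := by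
  intro i s x hs hne
  obtain ⟨s₁, hs₁, hne₁⟩ := ne_zero_on_halfPlane_of_ne_zero (hE i x) hc hs hne
  exact hP i s₁ x hs₁ hne₁

/-! ## §2 The K1-b♮ block from four letters -/

open Classical in
/-- **(K1b-♮) THE LINE-TERM PACKAGE FROM FOUR LETTERS** (ED. 1, interface of record).  Socket prefix VERBATIM (`L e dV hdV hdV0 dW hdW hdW0 lam hlam hw 𝒦 h𝒦 f hstd hcont`, the carrier
`νN β hβ hβ0 hβtop K hK hβK`, O41.4's `wq hwq`); then BY VALUE about ONE function `E`: (hol) holomorphy on `{0 < re}`; (pin) the TOP's normalised middle-cell identity `= E S s h` on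
`{n∕2 < re s}` for rank-one `S` (★ ED. 20 :112–:120 bytes); (dec) `τb hτb Nb hdec` in the TOP's shape; (supp½) support with `(Cb, κb)` ON `{n∕2 < re s}` ONLY.  CONCLUSION = the twelve
K1-b♮ letters of ★ ED. 20 :109–:126 TOKEN FOR TOKEN (`Ebc := E`; `hsuppb` on `{0 < re s}` by §1, the conclusion of a support letter being `s`-free).
[cite: KudlaRallis1994, §2 (2.10)–(2.12)] [cite: MoeglinWaldspurger1995, II.1.7, IV.1.9] [cite: Tan1999, §4 Prop. 4.8] [cite: Shimura1997, §18.4 Prop. 18.14] -/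
theorem exists_kindOne_lineTermPackage_of_letters
    (L : Type) [Field L] [NumberField L] [IsCMField L] {n : ℕ} (e : Fin 2 × Fin 1 ≃ Fin n)
    (dV : Fin 2 → L) (hdV : ∀ i, IsCMField.complexConj L (dV i) = dV i) (_hdV0 : ∀ i, dV i ≠ 0)
    (dW : Fin 1 → L) (hdW : ∀ i, IsCMField.complexConj L (dW i) = dW i) (_hdW0 : ∀ i, dW i ≠ 0)
    (lam : IdeleClassGroup L →ₜ* Circle) (_hlam : IsConjugateSymplectic L lam) (_hw : HasWeight L lam 1)
    (𝒦 : IwasawaDatum L e dV hdV dW hdW) (_h𝒦 : 𝒦.IsStd) (f : ℂ → HA L e dV hdV dW hdW → ℂ)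
    (_hstd : IsStandardSectionFamily 𝒦 (toHeckeCharacter L lam⁻¹) f) (_hcont : ∀ s, Continuous (f s))
    [MeasurableSpace (unipDelta L e dV hdV dW hdW)] [BorelSpace (unipDelta L e dV hdV dW hdW)]
    (νN : Measure (unipDelta L e dV hdV dW hdW)) [νN.IsHaarMeasure]
    (β : unipDelta L e dV hdV dW hdW → ℝ≥0∞) (_hβ : IsCoveringWeight (unipDeltaRat L e dV hdV dW hdW) β)
    (_hβ0 : ∫⁻ u, β u ∂νN ≠ 0) (_hβtop : ∫⁻ u, β u ∂νN ≠ ∞)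
    {K : Set (unipDelta L e dV hdV dW hdW)} (_hK : IsCompact K) (_hβK : ∀ u, β u ≤ K.indicator 1 u)
    (wq : unipDeltaRat L e dV hdV dW hdW → ratH L e dV hdV dW hdW)
    (_hwq : ∀ ν, ((wq ν : ratH L e dV hdV dW hdW) : HA L e dV hdV dW hdW) = weylDelta L e dV hdV dW hdW * ((ν : unipDelta L e dV hdV dW hdW) : HA L e dV hdV dW hdW))
    -- THE FOUR LETTERS about ONE function `E`
    (E : skewMatrices ((IsCMField.complexConj L : L ≃ₐ[Fp L] L) : L →+* L) ((gramR L e dV hdV dW hdW).map (algebraMap (Fp L) L)) → ℂ → HA L e dV hdV dW hdW → ℂ)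
    (hEd : ∀ S x, DifferentiableOn ℂ (fun s => E S s x) {s : ℂ | 0 < s.re})
    (hpin : ∀ S : skewMatrices ((IsCMField.complexConj L : L ≃ₐ[Fp L] L) : L →+* L) ((gramR L e dV hdV dW hdW).map (algebraMap (Fp L) L)),
      (S : Matrix (Fin n) (Fin n) L) ≠ 0 → (S : Matrix (Fin n) (Fin n) L).det = 0 → ∀ (s : ℂ) (h : HA L e dV hdV dW hdW), (n : ℝ) / 2 < s.re →
        ((∫⁻ u, β u ∂νN).toReal⁻¹ : ℝ) •
          (∫ u, (β u).toReal • (conj (unipDeltaChar L e dV hdV dW hdW (S : Matrix (Fin n) (Fin n) L) (u : HA L e dV hdV dW hdW) : ℂ) *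
            (∑' q : ↥(({Quotient.mk (MulAction.orbitRel (siegelDeltaRat L e dV hdV dW hdW) (ratH L e dV hdV dW hdW)) 1} ∪
              Set.range (fun ν : unipDeltaRat L e dV hdV dW hdW =>
                (Quotient.mk (MulAction.orbitRel (siegelDeltaRat L e dV hdV dW hdW) (ratH L e dV hdV dW hdW)) (wq ν) :
                  SiegelDeltaQuot L e dV hdV dW hdW)))ᶜ : Set (SiegelDeltaQuot L e dV hdV dW hdW)),
              f s ((((Quotient.out (q : SiegelDeltaQuot L e dV hdV dW hdW) : ratH L e dV hdV dW hdW) : HA L e dV hdV dW hdW)) *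
                ((u : HA L e dV hdV dW hdW) * h)))) ∂νN) = E S s h)
    (τb : skewMatrices ((IsCMField.complexConj L : L ≃ₐ[Fp L] L) : L →+* L) ((gramR L e dV hdV dW hdW).map (algebraMap (Fp L) L)) → ℝ)
    (hτb : ∀ S : skewMatrices ((IsCMField.complexConj L : L ≃ₐ[Fp L] L) : L →+* L) ((gramR L e dV hdV dW hdW).map (algebraMap (Fp L) L)),
      ‖(fun i j => NumberField.mixedEmbedding L ((S : Matrix (Fin n) (Fin n) L) i j))‖ ≤ τb S) (Nb : ℕ)
    (hdec : ∀ z : ℂ, 0 < z.re → ∃ C a c a' r : ℝ, 0 ≤ C ∧ 0 ≤ a ∧ 0 < c ∧ 0 ≤ a' ∧ 0 < r ∧ ∀ S (s : ℂ), dist s z < r → ∀ h : HA L e dV hdV dW hdW,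
      ‖E S s h‖ ≤ C * adelicHeightGL (n + n) L (h : GL (Fin (n + n)) (AdeleRing (𝓞 L) L)) ^ a *
        (Real.exp (-(c * adelicHeightGL (n + n) L (h : GL (Fin (n + n)) (AdeleRing (𝓞 L) L)) ^ (-a') * τb S)) * (1 + τb S) ^ Nb))
    {Cb κb : ℝ} (hCb : 0 < Cb) (hκb : 0 ≤ κb)
    (hsupp : ∀ S (s : ℂ) (h : HA L e dV hdV dW hdW), (n : ℝ) / 2 < s.re → E S s h ≠ 0 →
      ∃ D : ℕ, 1 ≤ D ∧ (D : ℝ) ≤ Cb * adelicHeightGL (n + n) L (h : GL (Fin (n + n)) (AdeleRing (𝓞 L) L)) ^ κb ∧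
        ∀ i j, IsIntegral ℤ ((D : L) * (S : Matrix (Fin n) (Fin n) L) i j)) :
    ∃ (Ebc : skewMatrices ((IsCMField.complexConj L : L ≃ₐ[Fp L] L) : L →+* L) ((gramR L e dV hdV dW hdW).map (algebraMap (Fp L) L)) → ℂ → HA L e dV hdV dW hdW → ℂ),
      (∀ S x, DifferentiableOn ℂ (fun s => Ebc S s x) {s : ℂ | 0 < s.re}) ∧
      (∀ S : skewMatrices ((IsCMField.complexConj L : L ≃ₐ[Fp L] L) : L →+* L) ((gramR L e dV hdV dW hdW).map (algebraMap (Fp L) L)),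
        (S : Matrix (Fin n) (Fin n) L) ≠ 0 → (S : Matrix (Fin n) (Fin n) L).det = 0 → ∀ (s : ℂ) (h : HA L e dV hdV dW hdW), (n : ℝ) / 2 < s.re →
          ((∫⁻ u, β u ∂νN).toReal⁻¹ : ℝ) •
            (∫ u, (β u).toReal • (conj (unipDeltaChar L e dV hdV dW hdW (S : Matrix (Fin n) (Fin n) L) (u : HA L e dV hdV dW hdW) : ℂ) *
              (∑' q : ↥(({Quotient.mk (MulAction.orbitRel (siegelDeltaRat L e dV hdV dW hdW) (ratH L e dV hdV dW hdW)) 1} ∪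
                Set.range (fun ν : unipDeltaRat L e dV hdV dW hdW =>
                  (Quotient.mk (MulAction.orbitRel (siegelDeltaRat L e dV hdV dW hdW) (ratH L e dV hdV dW hdW)) (wq ν) :
                    SiegelDeltaQuot L e dV hdV dW hdW)))ᶜ : Set (SiegelDeltaQuot L e dV hdV dW hdW)),
                f s ((((Quotient.out (q : SiegelDeltaQuot L e dV hdV dW hdW) : ratH L e dV hdV dW hdW) : HA L e dV hdV dW hdW)) *
                  ((u : HA L e dV hdV dW hdW) * h)))) ∂νN) = Ebc S s h) ∧
      ∃ (τb : skewMatrices ((IsCMField.complexConj L : L ≃ₐ[Fp L] L) : L →+* L) ((gramR L e dV hdV dW hdW).map (algebraMap (Fp L) L)) → ℝ),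
        (∀ S : skewMatrices ((IsCMField.complexConj L : L ≃ₐ[Fp L] L) : L →+* L) ((gramR L e dV hdV dW hdW).map (algebraMap (Fp L) L)),
          ‖(fun i j => NumberField.mixedEmbedding L ((S : Matrix (Fin n) (Fin n) L) i j))‖ ≤ τb S) ∧
        ∃ Nb : ℕ,
          (∀ z : ℂ, 0 < z.re → ∃ C a c a' r : ℝ, 0 ≤ C ∧ 0 ≤ a ∧ 0 < c ∧ 0 ≤ a' ∧ 0 < r ∧ ∀ S (s : ℂ), dist s z < r → ∀ h : HA L e dV hdV dW hdW,
            ‖Ebc S s h‖ ≤ C * adelicHeightGL (n + n) L (h : GL (Fin (n + n)) (AdeleRing (𝓞 L) L)) ^ a *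
              (Real.exp (-(c * adelicHeightGL (n + n) L (h : GL (Fin (n + n)) (AdeleRing (𝓞 L) L)) ^ (-a') * τb S)) * (1 + τb S) ^ Nb)) ∧
          ∃ Cb κb : ℝ, 0 < Cb ∧ 0 ≤ κb ∧
            (∀ S (s : ℂ) (h : HA L e dV hdV dW hdW), 0 < s.re → Ebc S s h ≠ 0 →
              ∃ D : ℕ, 1 ≤ D ∧ (D : ℝ) ≤ Cb * adelicHeightGL (n + n) L (h : GL (Fin (n + n)) (AdeleRing (𝓞 L) L)) ^ κb ∧
                ∀ i j, IsIntegral ℤ ((D : L) * (S : Matrix (Fin n) (Fin n) L) i j)) := by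
  have hn0 : (0 : ℝ) ≤ (n : ℝ) / 2 := by positivity
  exact ⟨E, hEd, hpin, τb, hτb, Nb, hdec, Cb, κb, hCb, hκb,
    support_of_support_on_halfPlane hEd hn0
      (P := fun S (h : HA L e dV hdV dW hdW) => ∃ D : ℕ, 1 ≤ D ∧ (D : ℝ) ≤ Cb * adelicHeightGL (n + n) L (h : GL (Fin (n + n)) (AdeleRing (𝓞 L) L)) ^ κb ∧
        ∀ i j, IsIntegral ℤ ((D : L) * (S : Matrix (Fin n) (Fin n) L) i j)) hsupp⟩

end Summit.HodgeConjecture.HodgeConjecture.Cruxes.HLiu418.K2LiuKindOneLineTermPackage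

end
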